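import Summits.AtomisticToContinuum.BoseEinsteinCondensation.Theorems.BECRieszReverseHolderCoarseGrainedReverseHolderReduction
import Summits.AtomisticToContinuum.BoseEinsteinCondensation.Theorems.BECRieszReverseHolderCoarseGrainedReverseHolderStubHeatSumLeRieszEnergy
import Summits.AtomisticToContinuum.BoseEinsteinCondensation.Theorems.BECRieszReverseHolderCoarseGrainedReverseHolderStubGibbsMeanEnergyNonpos
import Summits.AtomisticToContinuum.BoseEinsteinCondensation.Theorems.BECRieszReverseHolderCoarseGrainedReverseHolderStubStructureFactorBoundOf
import Summits.AtomisticToContinuum.BoseEinsteinCondensation.Theorems.BECRieszReverseHolderCoarseGrainedReverseHolderStubBosecornerOfStructureFactor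
import HarnessLib

/-!
# Route `BECRieszReverseHolder`, crux `CoarseGrainedReverseHolder` (stmt-AtomisticToContinuum-12840):
# the crux from shadow domination in VARIANCE form — all classical content proved

Supports (does not close) stmt-AtomisticToContinuum-12840 (line `registered`, lead c4, reshape of
2026-08-17: Cruxes/CoarseGrainedReverseHolder/Lines/registered.lean). Three registered named sub-goals:

* `shadowStructureFactorBound` — **the classical engine of the line, UNCONDITIONAL**: for the
  smeared zero-mean periodic Riesz-2 gas on the torus cell (`g = periodicRieszKernel 2 L η`,
  `H = Σ_{i<j} g(X_i − X_j)`), every coupling `b ≥ 0`, every `n`, `L > 0`, `η > 0` and every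
  smoothing time `t₀ > η²`, the Gibbs mean of the heat-smoothed density fluctuation
  `D_{t₀}(X) = Σ_{i,j} Θ_{L,t₀}(X_i − X_j)` (`= L⁻³ Σ_{k≠0} e^{-t₀|k|²}|ρ̂_X(k)|²`, a smooth structure
  factor) obeys `∫_{cell^n} D_{t₀} e^{-bH} ≤ [n g(0) / (2K₂(√t₀ − η))] ∫_{cell^n} e^{-bH}` — uniform in
  `L`, no corner condition (the landed stubs `stub_structureFactorBound_of`,
  `stub_heatSumLeRieszEnergy`, `stub_gibbsMeanEnergyNonpos`: `E_b[H] ≤ 0` by Chebyshev at the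
  centring `∫ H = 0`, and `Σ_{i,j} g = K₂ ∫_{η²}^∞ t^{-1/2} D_t dt ≥ 2K₂(√t₀−η) D_{t₀}` by positive
  type and heat-flow monotonicity).
* `shadowStructureFactor_bosecorner` — its Bose-corner form: along the dictionary
  `L = ((n+1)/ρ)^{1/3}`, `a = scatteringLength v`, `b = 2π^{-3/2}(a/ρ)^{1/2}`,
  `η = max((8πρa)^{-1/2}, ρ^{-1/3})`, the normalised smooth structure factor
  `W_n = (L³/n²) ∫ D_{ℓ²+4η²} e^{-bH} / ∫ e^{-bH}` is bounded eventually in `n`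
  (`stub_bosecornerOfStructureFactor`).
* `coarseGrainedReverseHolder_of_shadowVariance` — **the crux follows from the single open stub
  S3′** `stub_groundStateShadowVariance` (for non-negative ground states `Φ`,
  `F_{n,ℓ}(Φ) ≤ A(1 + W_n)`): S3′ + `shadowStructureFactor_bosecorner` bound `F_{n,ℓ}` on
  non-negative ground states, and the landed first layer `stub_cruxOfGroundStateBound`
  (compactness + `L²`-Lipschitz transfer) gives the crux. S3′ is implied by the crux (`W_n ≥ 0`),
  so after this file the line `registered` is closed modulo exactly the Bose–Riesz membership in
  variance form (informal item stmt-AtomisticToContinuum-12602), the open content.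

Pure composition over landed theorems.
-/

namespace Summit.AtomisticToContinuum.BoseEinsteinCondensation.Theorems.CoarseGrainedReverseHolder

open Literature.MathematicalPhysics.QuantumManyBody
open Literature.MathematicalPhysics.StatisticalMechanics
open Summit.AtomisticToContinuum.BoseEinsteinCondensation.Theses.BECRieszReverseHolder

/-- **The classical engine of line `registered`, unconditional**: the `L`-uniform smooth
structure-factor bound of the one-component smeared periodic Riesz-2 gas at every coupling
`b ≥ 0`: `∫_{cell^n} D_{t₀} e^{-bH} ≤ [n g(0)/(2K₂(√t₀ − η))] ∫_{cell^n} e^{-bH}` for `η² < t₀`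
(`D_{t₀} = Σ_{i,j} Θ_{L,t₀}(X_i − X_j)`, `g = periodicRieszKernel 2 L η`, `K₂ = rieszSubordinationConst 2`).
[folklore] -/
theorem shadowStructureFactorBound : ∀ (n : ℕ) (L b η t₀ : ℝ), 0 < L → 0 ≤ b → 0 < η → η ^ 2 < t₀ → ∀ H : BoseGas.Config n → ℝ, H = (fun X => ∑ i : Fin n, ∑ j : Fin n with i < j, periodicRieszKernel 2 L η (X i - X j)) → ∫ X in BoseGas.cellN n L, (∑ i : Fin n, ∑ j : Fin n, periodicHeatSum L t₀ (X i - X j)) * Real.exp (-(b * H X)) ≤ (n : ℝ) * periodicRieszKernel 2 L η 0 / (2 * rieszSubordinationConst 2 * (Real.sqrt t₀ - η)) * ∫ X in BoseGas.cellN n L, Real.exp (-(b * H X)) :=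
  stub_structureFactorBound_of stub_heatSumLeRieszEnergy stub_gibbsMeanEnergyNonpos

/-- **Bose-corner form of the engine**: along the Bose dictionary the normalised smooth structure
factor `W_n = (L³/n²) ∫ D_{ℓ²+4η²} e^{-bH} / ∫ e^{-bH}` of the shadow gas is bounded eventually in
`n`, for every admissible `v`, small `ρ` and every `ℓ > 0`. [folklore] -/
theorem shadowStructureFactor_bosecorner : ∀ v : ℝ → ENNReal, BoseGas.IsRepulsiveFiniteRange v → ∃ ρ₀ : ℝ, 0 < ρ₀ ∧ ∀ ρ : ℝ, 0 < ρ → ρ < ρ₀ → ∀ ℓ : ℝ, 0 < ℓ → ∃ C : ℝ, ∀ᶠ n : ℕ in Filter.atTop, ∀ (L : ℝ), L = BoseGas.sideLength ρ (n + 1) → ∀ (a : ℝ), a = (BoseGas.scatteringLength v).toReal → ∀ (b : ℝ), b = 2 * Real.pi ^ (-(3 / 2 : ℝ)) * (a / ρ) ^ (1 / 2 : ℝ) → ∀ (η : ℝ), η = max ((8 * Real.pi * ρ * a) ^ (-(1 / 2 : ℝ))) (ρ ^ (-(1 / 3 : ℝ))) → ∀ (H : BoseGas.Config n → ℝ), H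 = (fun X => ∑ i : Fin n, ∑ j : Fin n with i < j, periodicRieszKernel 2 L η (X i - X j)) → L ^ 3 / (n : ℝ) ^ 2 * ((∫ X in BoseGas.cellN n L, (∑ i : Fin n, ∑ j : Fin n, periodicHeatSum L (ℓ ^ 2 + 4 * η ^ 2) (X i - X j)) * Real.exp (-(b * H X))) / (∫ X in BoseGas.cellN n L, Real.exp (-(b * H X)))) ≤ C :=
  stub_bosecornerOfStructureFactor shadowStructureFactorBound

/-- **The crux from S3′ alone.** If every non-negative ground state `Φ` of the dilute gas obeys
the shadow-variance domination `F_{n,ℓ}(Φ) ≤ A(1 + W_n)` (registered stub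
`stub_groundStateShadowVariance` of line `registered`; the Bose–Riesz membership in variance
form), then `CoarseGrainedReverseHolder` holds: `W_n ≤ C` eventually
(`shadowStructureFactor_bosecorner`) bounds `F_{n,ℓ}` on non-negative ground states by
`max A 0 · (1 + max C 0)`, and the landed reduction `stub_cruxOfGroundStateBound` transfers the
bound to all non-negative near-minimisers. [folklore] -/
theorem coarseGrainedReverseHolder_of_shadowVariance : (∀ v : ℝ → ENNReal, BoseGas.IsRepulsiveFiniteRange v → ∃ ρ₀ : ℝ, 0 < ρ₀ ∧ ∀ ρ : ℝ, 0 < ρ → ρ < ρ₀ → ∀ ℓ : ℝ, 0 < ℓ → ∃ A : ℝ, ∀ᶠ n : ℕ in Filter.atTop, ∀ (L : ℝ), L = BoseGas.sideLength ρ (n + 1) → ∀ (m : ℕ), m = ⌊L / ℓ⌋₊ → ∀ (a : ℝ), a = (BoseGas.scatteringLength v).toReal → ∀ (b : ℝ), b = 2 * Real.pi ^ (-(3 / 2 : ℝ)) * (a / ρ) ^ (1 / 2 : ℝ) → ∀ (η : ℝ), η = max ((8 * Real.pi * ρ * a) ^ (-(1 / 2 : ℝ))) (ρ ^ (-(1 /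 3 : ℝ))) → ∀ (H : BoseGas.Config n → ℝ), H = (fun X => ∑ i : Fin n, ∑ j : Fin n with i < j, periodicRieszKernel 2 L η (X i - X j)) → ∀ Φ : BoseGas.Config (n + 1) → ℂ, BoseGas.IsGroundState v L Φ → (∀ X, Φ X = (‖Φ X‖ : ℂ)) → (m : ENNReal) ^ 3 * ∫⁻ X : Fin n → EuclideanSpace ℝ (Fin 3), ((∑ k : Fin 3 → Fin m, (∫⁻ y in {y : EuclideanSpace ℝ (Fin 3) | ∀ i, y i ∈ Set.Ico ((k i : ℝ) * (L / m)) (((k i : ℝ) + 1) * (L / m))}, (‖Φ (Matrix.vecCons y X)‖₊ : ENNReal) ^ 2) ^ 2) / (∫⁻ y, (‖Φ (Matrix.vecCons y X)‖₊ : ENNReal) ^ 2)) ≤ ENNReal.ofReal A * (1 + ENNReal.ofReal (L ^ 3 / (n : ℝ) ^ 2 * ((∫ X in BoseGas.cellN n L, (∑ i : Fin n, ∑ j : Fin n, periodicHeatSum L (ℓ ^ 2 + 4 * η ^ 2) (X i - X j)) * Real.exp (-(b * H X))) / (∫ X in BoseGas.cellN n L, Real.exp (-(b * H X))))))) → CoarseGrainedReverseHolder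 := by
  intro hS3
  refine stub_cruxOfGroundStateBound fun v hv => ?_
  obtain ⟨ρ₂, hρ₂, h2⟩ := hS3 v hv
  obtain ⟨ρ₃, hρ₃, h3⟩ := shadowStructureFactor_bosecorner v hv
  refine ⟨min ρ₂ ρ₃, lt_min hρ₂ hρ₃, fun ρ hρ hρlt ℓ hℓ => ?_⟩
  have hρ₂' : ρ < ρ₂ := hρlt.trans_le (min_le_left _ _)
  have hρ₃' : ρ < ρ₃ := hρlt.trans_le (min_le_right _ _)
  obtain ⟨A, hA⟩ := h2 ρ hρ hρ₂' ℓ hℓ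
  obtain ⟨C, hC⟩ := h3 ρ hρ hρ₃' ℓ hℓ
  refine ⟨max A 0 * (1 + max C 0), ?_⟩
  filter_upwards [hA, hC] with n hAn hCn
  intro Φ hΦgs hΦpos
  have hΦF := hAn _ rfl _ rfl _ rfl _ rfl _ rfl _ rfl Φ hΦgs hΦpos
  have hCn' := hCn _ rfl _ rfl _ rfl _ rfl _ rfl
  dsimp only at hΦF hCn' ⊢
  calc _ ≤ ENNReal.ofReal (max A 0) * (1 + ENNReal.ofReal (max C 0)) := by
        refine hΦF.trans ?_
        gcongr ENNReal.ofReal ?_ * (1 + ?_)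
        · exact le_max_left _ _
        · exact ENNReal.ofReal_le_ofReal (hCn'.trans (le_max_left _ _))
    _ = ENNReal.ofReal (max A 0 * (1 + max C 0)) := by
        rw [ENNReal.ofReal_mul (le_max_right _ _), ENNReal.ofReal_add zero_le_one (le_max_right _ _),
          ENNReal.ofReal_one]

end Summit.AtomisticToContinuum.BoseEinsteinCondensation.Theorems.CoarseGrainedReverseHolder
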